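import Literature.MathematicalPhysics.QuantumFieldTheory.Balaban1983to89.B9PinMembersKLevelV1

/-!
# `Balaban1983to89.B9Cor35ComparisonsGA` — [B9] Cor. 3.5 p. 407 at `U = 1` for the operator `G(U)` of Theorem 3.3: the kernel family
# `GAOfOps 𝔬` of `G(U)` READ FROM ITS LETTERS (a pin in the pattern of `B9Thm37Whole.E37OfOps`), and the five `U = 1` comparisons of the
# N06 knit (`hGA_e`, `hGA_h1`, `hGA_e4`, `hGA_h2`, `hGA_l2`) against NODE 00's reading `Node00.GU` of [4] Prop. 2.6, as EQUALITIES

B9 = T. Bałaban, *Propagators for lattice gauge theories in a background field*, Commun. Math. Phys. **99** (1985) 389–434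
[Balaban1985BackgroundPropagators]; [4] = B6 = T. Bałaban, *Propagators and renormalization transformations for lattice gauge theories. II*,
Commun. Math. Phys. **96** (1984) 223–250 [Balaban1984PropagatorsII].

statement-level skeleton of published theorems with citation tags; proofs where landed; nothing here is a claim about the Yang–Mills mass gap

THE PRINTED LOCI (held text `paper:balaban1985-cmp99-background-propagators`, read 2026-08-26).  p. 399 [PDF 11], Theorem 3.3: *"… the operator G(U)
(a = 1) satisfies the inequalities (3.42)–(3.47), with G′(U) replaced by G(U) and λ replaced by a function J defined at bonds of the lattice T_η, or Ω₀,
and with values in 𝔤."*; p. 399: *"This way the theorems are reduced to the corresponding theorems for propagators without external gauge field. They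
were proved in [4]."*; p. 407 [PDF 19]: *"This allows us to prove Theorems 3.1–3.3 in some special situations, where we can use the results of [4].
There we have proved these theorems for operators with the external gauge field configuration U = 1. Applying the results of that paper together with
the above results we get Corollary 3.5."*  [4] p. 247, Prop. 2.6 (2.136)–(2.140) = the entries of `G = Δ_a⁻¹` (r03's census readings
`B6Prop26Census2136KLevelV1.kG`, NODE 00's `Node00.GU`).

THE POINT.  The N06 certificate at the Stage-11 record (`BalabanUVNodesN06AtRecord11CB10YZW.b9_main_of_up_view₁₁B10YZW_of_obligations`, binders
:217–:230) displays the five `U = 1` comparisons of the operator layer's kernel family `(ops x).GA` of `G(U)` against `Node00.GU x.toKIdx` (the fields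
`GA_e … GA_l2` of `B9FromB6.DictAtOne` at `B9PinGeometryKLevelV1.dictAtOneY`) and the two null readings of `GA.e4`, `GA.h2` on the SITE summand of
`Node00.KLoc`.  The layer `ops` is a FREE parameter record (def-Y's `B9PinCarriersKLevelV1.OperatorLayerY`); THIS FILE types THE PIN of its field `GA`:
* §1 `embW w` (`J ↦ J·w` into a real normed space `W`; at the record `M_N(ℂ)` ⊇ 𝔤) and the NORM versions `supInW` ∕ `holderQW` ∕ `l2OfW` ∕ `wNormW` of r03's
  census readings `supIn` ∕ `holderQ` ∕ `l2Of` and n03-b's `wNormB` — equal to the scalar readings on embedded scalars when `‖w‖ = 1` (`…_embW`).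
* §2 `GAOps W S i B` — THE LETTERS OF `G(U)` AT ONE MEMBER as total functions of `U : B.Cfg` (`G U`, `D U ν` = ∇_{U,ν}, `Da U ν` = ∇*_{U,ν}, `Lap U` = Δ_U,
  real-linear on `W`-valued fine-bond functions) and polarisation vectors `w : S → W` — a PARAMETER RECORD (pattern of `B9Thm37Whole.Ops`);
  **`GAOfOps 𝔬 : B9.KernelFamily (geo9K i) B`** — the quantities (3.42)–(3.47) READ FROM THE LETTERS by r03's formulas verbatim (`Gop ↦ 𝔬.G U`,
  `∇_ν ↦ 𝔬.D U ν`, `∇*_ν ↦ 𝔬.Da U ν`, `Δ ↦ 𝔬.Lap U`, norms of `W`, `J ↦ embW (𝔬.w a) J`, supremum over `a : S`) at the carrier block `β b` on the BOND summand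
  of `KLoc` ∕ `KCut`, `0` on the site summand (the device of `Node00.GU`); `glob n` = `wNormW` at exponent `γ + [2, 1, 1, 0]_n` ((3.47)).
* §3 `GAOps.AtOne 𝔬` — the hypothesis schema «AT `U = 1` THE LETTERS ARE [4]'s ON THE EMBEDDED SCALARS» (p. 399 ∕ p. 407: G(1) = r03's `Gop i`,
  ∇_{1,ν} = `DV ν c_f`, ∇*_{1,ν} = `DVa ν c_f`, Δ_1 = `LapV c_f`; `‖w a‖ = 1`, `S` inhabited).  NOT asserted — its discharge is the instance (NODE 00 def-Y).
* §4 UNDER `AtOne`, THE FIVE COMPARISONS AS EQUALITIES `e_one_eq`, `h1_one_eq`, `e4_one_eq`, `h2_one_eq`, `l2_one_eq`; the null readings `e4_inl`, `h2_inl`.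
* §5 AT THE MEMBER TYPE `MemberY` — the binder shapes literally, for ANY backgrounds `B x` and ANY family `GA x : B9.KernelFamily (geo9Y x) (B x)` PINNED as
  `GA x = GAOfOps (𝔬 x)` with `(𝔬 x).AtOne`: `hGA_e_of_pin` … `hGA_l2_of_pin` (rows 4–8 of dag-lead's N06 assignment; rows 9–10, the null readings `hE4`∕`hH2`,
  follow from rows 6–7 by dag-n06-h's `B9Cor35ComparisonsEH.hE4_of_hGA_e4`∕`hH2_of_hGA_h2`, or from `e4_inl`∕`h2_inl` directly).

HONEST SCOPE ∕ LOCATED.  (1) Nothing of [B9] or [4] is asserted; the comparisons are identities of readings under the schema.  (2) THE POLARISED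
READING: `KLoc` carries SCALAR fine-bond functions `J`, print's `J` has «values in 𝔤»; this pin reads `J` as the test functions `J·w_a`, `a ∈ S`.  With `S` a
basis of 𝔤 of unit vectors these control print's quantities for every 𝔤-valued `J` up to the factor `dim 𝔤 × (basis constant)` by real-linearity; a
reading by a supremum over ALL 𝔤-valued `J′` with `|J′| ≤ |J|` would NOT meet the `U = 1` comparison (it reads the absolute kernel of [4]'s `G`, which
exceeds the signed reading `kG`) — so «≤ `Node00.GU` at `U = 1`» forces a polarised reading; recorded, not hidden.  (3) `glob` (3.47) at `U = 1` is not
compared (no [4] counterpart: the residual `B9FromB6.ResidualGAGlobAtOne`, row 12).  (4) One finite lattice programme; count-neutral; N06 NOT discharged;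
NOT continuum ∕ OS ∕ mass gap ∕ Clay.  No `sorry` ∕ `axiom` ∕ `instance` ∕ `notation`.  Cell `pub-ymgap` (HUMAN RULING D-0062), Track A node N06, seat
`pub-ymgap-dag-n06-g` (bundle F2 of dag-lead's N06-ASSIGNMENT v1, director-ym LINE №87), 2026-08-26.
-/

noncomputable section

namespace Literature.MathematicalPhysics.QuantumFieldTheory.Balaban1983to89.B9Cor35ComparisonsGA

open LatticeFieldCalculus
open B6SectAOperatorsV1 (BondIdx)
open B6GlobalChartV1 (PV domT blkV1)
open B6Geom246MultiLevelTorus (geomT)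
open B6Ineq2142KLevelV1 (β)
open B6KLevelCensusIndexV1 (KIdx Adm)
open B6GradLegKLevelV1 (DV)
open B6LapLegKLevelV1 (DVa LapV)
open B6Prop26Census2136KLevelV1 (Gop supIn holderQ l2Of kG)
open B8ScaledSupNorm (msup weight)
open B9GeoNormsKLevelV1 (geo9K wNormB)
open B9PinMembersKLevelV1 (MemberY geo9Y)
open Node00 (kGeoU KLoc KCut GU)

variable {d ℓ : ℕ} {hd : 1 ≤ d + 1} {hL : Odd (ℓ + 1) ∧ 1 < ℓ + 1} {b₀ b₁ : ℝ}

/-! ## §1 Scalar fine-bond functions embedded into `W`-valued ones; the norm versions of the census readings -/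

section Emb

variable {X : Type} {W : Type} [NormedAddCommGroup W] [NormedSpace ℝ W]

/-- **The polarised embedding `J ↦ J·w`** of scalar functions into `W`-valued functions (print's test functions «J … with values in 𝔤», Thm 3.3
p. 399, along one direction `w`), as a real-linear map. [cite: Balaban1985BackgroundPropagators, Thm 3.3 p.399 («J … with values in 𝔤»; reading)] -/
def embW (w : W) : (X → ℝ) →ₗ[ℝ] (X → W) where
  toFun f := fun x => f x • w
  map_add' f g := by
    funext x
    simp only [Pi.add_apply, add_smul]
  map_smul' c f := by
    funext x
    simp only [Pi.smul_apply, smul_eq_mul, RingHom.id_apply, mul_smul]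

/-- `(J·w)(x) = J(x)·w`. [cite: Balaban1985BackgroundPropagators, Thm 3.3 p.399 (reading; bookkeeping)] -/
@[simp] theorem embW_apply (w : W) (f : X → ℝ) (x : X) : embW w f x = f x • w := rfl

/-- on a unit vector the embedding is pointwise norm-preserving: `‖(J·w)(x)‖ = |J(x)|`. [cite: Balaban1985BackgroundPropagators, (3.39) p.397 (the sup norm; bookkeeping)] -/
theorem norm_embW_apply {w : W} (hw : ‖w‖ = 1) (f : X → ℝ) (x : X) : ‖embW w f x‖ = |f x| := by
  rw [embW_apply, norm_smul, hw, mul_one, Real.norm_eq_abs]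

/-- **the flat `L²` norm of `h·f` for `W`-valued `f`**: `(Σ_x (h(x)‖f(x)‖)²)^{1/2}` — the norm version of r03's `l2Of` ((2.140) ∕ (3.46)).
[cite: Balaban1985BackgroundPropagators, (3.46) p.398; Balaban1984PropagatorsII, (2.140) p.247] -/
def l2OfW {Y : Type} [Fintype Y] (h : Y → ℝ) (f : Y → W) : ℝ :=
  Real.sqrt (∑ x, (h x * ‖f x‖) ^ 2)

/-- on embedded scalars `l2OfW` IS r03's `l2Of`. [cite: Balaban1984PropagatorsII, (2.140) p.247 (bookkeeping)] -/
theorem l2OfW_embW {Y : Type} [Fintype Y] {w : W} (hw : ‖w‖ = 1) (h f : Y → ℝ) : l2OfW h (embW w f) = l2Of h f := by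
  unfold l2OfW l2Of
  simp only [norm_embW_apply hw, mul_pow, sq_abs]

end Emb

section Readings

variable {W : Type} [NormedAddCommGroup W] [NormedSpace ℝ W]

/-- **`sup_{x ∈ Δ(y)} ‖f(x)‖`** for a `W`-valued fine-bond function — the norm version of r03's `supIn` ((2.136) ∕ (3.42): «for x ∈ Δ(y)»).
[cite: Balaban1985BackgroundPropagators, (3.42) p.397; Balaban1984PropagatorsII, (2.136) p.247] -/
def supInW (i : KIdx d ℓ hd hL b₀ b₁) (y : (geomT i.D).Site) (f : PBond (PV d ℓ i.m i.K hd hL) 0 → W) : ℝ :=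
  ⨆ x : {x : PBond (PV d ℓ i.m i.K hd hL) 0 // blkV1 i.hN i.D x = y}, ‖f x.1‖

open Classical in
/-- **the Hölder quotient of `ζ·f` over the admissible ordered pairs** for a `W`-valued `f` — the norm version of r03's `holderQ` ((2.137)∕(2.139) ∕
(3.43)∕(3.45), quotient `|x − x′|_phys^{−α}‖ζ(x)f(x) − ζ(x′)f(x′)‖`). [cite: Balaban1985BackgroundPropagators, (3.40) + (3.43) pp.397–398; Balaban1984PropagatorsII, (2.137) p.247] -/
def holderQW (i : KIdx d ℓ hd hL b₀ b₁) (α : ℝ) (ζ : PBond (PV d ℓ i.m i.K hd hL) 0 → ℝ) (f : PBond (PV d ℓ i.m i.K hd hL) 0 → W) : ℝ :=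
  ⨆ q : PBond (PV d ℓ i.m i.K hd hL) 0 × PBond (PV d ℓ i.m i.K hd hL) 0,
    if Adm i q.1 q.2 then ((((supDist q.1.src q.2.src : ℕ) : ℝ)) * |i.cf|⁻¹) ^ (-α) * ‖ζ q.1 • f q.1 - ζ q.2 • f q.2‖ else 0

/-- **the weighted supremum norm (3.41) of a `W`-valued fine-bond function** — r05's `msup` with n03-b's membership «the block of the bond has level j»
(the norm version of `B9GeoNormsKLevelV1.wNormB`). [cite: Balaban1985BackgroundPropagators, (3.41) p.397] -/
def wNormW (i : KIdx d ℓ hd hL b₀ b₁) (γ : ℝ) (f : PBond (PV d ℓ i.m i.K hd hL) 0 → W) : ℝ :=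
  msup (ℓ + 1) i.k |i.cf|⁻¹ γ (fun j (x : PBond (PV d ℓ i.m i.K hd hL) 0) => (blkV1 i.hN i.D x).1.1 = j) f

/-- on embedded scalars `supInW` IS r03's `supIn`. [cite: Balaban1984PropagatorsII, (2.136) p.247 (bookkeeping)] -/
theorem supInW_embW (i : KIdx d ℓ hd hL b₀ b₁) {w : W} (hw : ‖w‖ = 1) (y : (geomT i.D).Site) (f : PBond (PV d ℓ i.m i.K hd hL) 0 → ℝ) :
    supInW i y (embW w f) = supIn i y f := by
  unfold supInW supIn
  simp only [norm_embW_apply hw]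

/-- on embedded scalars `holderQW` IS r03's `holderQ`. [cite: Balaban1984PropagatorsII, (2.137) p.247 (bookkeeping)] -/
theorem holderQW_embW (i : KIdx d ℓ hd hL b₀ b₁) {w : W} (hw : ‖w‖ = 1) (α : ℝ) (ζ f : PBond (PV d ℓ i.m i.K hd hL) 0 → ℝ) :
    holderQW i α ζ (embW w f) = holderQ i α ζ f := by
  have key : ∀ x x' : PBond (PV d ℓ i.m i.K hd hL) 0, ‖ζ x • embW w f x - ζ x' • embW w f x'‖ = |ζ x * f x - ζ x' * f x'| := by
    intro x x'
    rw [embW_apply, embW_apply, smul_smul, smul_smul, ← sub_smul, norm_smul, hw, mul_one, Real.norm_eq_abs]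
  unfold holderQW holderQ
  simp only [key]

/-- on embedded scalars `wNormW` IS n03-b's `wNormB`. [cite: Balaban1985BackgroundPropagators, (3.41) p.397 (bookkeeping)] -/
theorem wNormW_embW (i : KIdx d ℓ hd hL b₀ b₁) {w : W} (hw : ‖w‖ = 1) (γ : ℝ) (f : PBond (PV d ℓ i.m i.K hd hL) 0 → ℝ) :
    wNormW i γ (embW w f) = wNormB i γ f := by
  unfold wNormW wNormB msup
  simp only [norm_embW_apply hw, Real.norm_eq_abs]

end Readings

/-! ## §2 The letters of `G(U)` at one member and the kernel family read from them -/

section Letters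

variable (W : Type) [NormedAddCommGroup W] [NormedSpace ℝ W] (S : Type)

/-- **THE LETTERS OF `G(U)` AT ONE MEMBER** `i` over backgrounds `B`, as total functions of `U : B.Cfg` acting real-linearly on the `W`-valued functions on the
fine bonds of the member's torus: `G U` = G(U) (= `Δ_a(U)⁻¹`, (3.27) p. 395 with a = 1, the operator of Theorem 3.3), `D U ν` = the covariant derivative ∇_{U,ν}
((3.3) p. 390), `Da U ν` = the letter of its adjoint direction ∇*_{U,ν} ((3.8) p. 392), `Lap U` = Δ_U; `w : S → W` = the polarisation vectors along which scalar
test functions are read (module docstring, LOCATED (2); at the record: `W := 𝔸`, `S :=` the unit sphere of `𝔸` or a unit basis of 𝔤, `w := Subtype.val`, the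
letters the `ℝ`-restrictions of the instance's `ℂ`-linear lattice operators).  A PARAMETER RECORD — nothing constructed or asserted (pattern of `B9Thm37Whole.Ops`).
[cite: Balaban1985BackgroundPropagators, (3.3) p.390, (3.8) p.392, (3.27) p.395, Thm 3.3 p.399] -/
structure GAOps (i : KIdx d ℓ hd hL b₀ b₁) (B : B9.Backgrounds) where
  w : S → W
  G : B.Cfg → Module.End ℝ (PBond (PV d ℓ i.m i.K hd hL) 0 → W)
  D : B.Cfg → Fin (d + 1) → Module.End ℝ (PBond (PV d ℓ i.m i.K hd hL) 0 → W)
  Da : B.Cfg → Fin (d + 1) → Module.End ℝ (PBond (PV d ℓ i.m i.K hd hL) 0 → W)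
  Lap : B.Cfg → Module.End ℝ (PBond (PV d ℓ i.m i.K hd hL) 0 → W)

variable {W S} {i : KIdx d ℓ hd hL b₀ b₁} {B : B9.Backgrounds}

/-- **THE KERNEL FAMILY OF `G(U)` READ FROM ITS LETTERS** over the member's [B9] geometry `geo9K i` (dag-n03-b's reading of `Node00.kGeoU i`): on the BOND
summand `J` of `KLoc i` (and of `KCut i`), r03's census formulas of `B6Prop26Census2136KLevelV1.kG` VERBATIM with the [4] letters replaced by the `U`-dependent
ones and `J` polarised along `w a`, supremum over `a : S` — `e 0..3` = sup over `x ∈ Δ(y)` (and the direction) of `‖(G(U)J)(x)‖, ‖(∇_{U,ν}G(U)J)(x)‖,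
‖(G(U)∇*_{U,ν}J)(x)‖, ‖(Δ_UG(U)J)(x)‖` ((3.42)), `h1` ((3.43)), `e4` ((3.44)), `h2` ((3.45)), `l2 0..5` ((3.46)), `glob 0..3` = the weighted norms (3.41) of
the four quantities at exponents `γ + 2, γ + 1, γ + 1, γ` ((3.47)) — at the carrier block `β b` of the bond `b`; `0` on the SITE summand (the device of `Node00.GU`).
[cite: Balaban1985BackgroundPropagators, Thm 3.3 p.399 + (3.42)–(3.47) pp.397–398; Balaban1984PropagatorsII, Prop. 2.6 (2.136)–(2.140) p.247] -/
def GAOfOps (𝔬 : GAOps W S i B) : B9.KernelFamily (geo9K i) B where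
  e n U lam b := match lam with
    | .inr J => ⨆ a : S, (![supInW i (β i.hN i.D i.hk b) (𝔬.G U (embW (𝔬.w a) J)),
        ⨆ ν : Fin (d + 1), supInW i (β i.hN i.D i.hk b) ((𝔬.D U ν ∘ₗ 𝔬.G U) (embW (𝔬.w a) J)),
        ⨆ ν : Fin (d + 1), supInW i (β i.hN i.D i.hk b) ((𝔬.G U ∘ₗ 𝔬.Da U ν) (embW (𝔬.w a) J)),
        supInW i (β i.hN i.D i.hk b) ((𝔬.Lap U ∘ₗ 𝔬.G U) (embW (𝔬.w a) J))] : Fin 4 → ℝ) n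
    | .inl _ => 0
  h1 U lam α ζ := match lam, ζ with
    | .inr J, .inr z => ⨆ a : S, max (⨆ ν : Fin (d + 1), holderQW i α z ((𝔬.D U ν ∘ₗ 𝔬.G U) (embW (𝔬.w a) J)))
        (⨆ ν : Fin (d + 1), holderQW i α z ((𝔬.G U ∘ₗ 𝔬.Da U ν) (embW (𝔬.w a) J)))
    | _, _ => 0
  e4 U lam b := match lam with
    | .inr J => ⨆ a : S, ⨆ ν : Fin (d + 1), ⨆ μ : Fin (d + 1),
        supInW i (β i.hN i.D i.hk b) ((𝔬.D U ν ∘ₗ 𝔬.G U ∘ₗ 𝔬.Da U μ) (embW (𝔬.w a) J))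
    | .inl _ => 0
  h2 U lam α ζ := match lam, ζ with
    | .inr J, .inr z => ⨆ a : S, ⨆ ν : Fin (d + 1), ⨆ μ : Fin (d + 1),
        holderQW i α z ((𝔬.D U ν ∘ₗ 𝔬.G U ∘ₗ 𝔬.Da U μ) (embW (𝔬.w a) J))
    | _, _ => 0
  l2 n U lam h := match lam, h with
    | .inr J, .inr z => ⨆ a : S, (![l2OfW z (𝔬.G U (embW (𝔬.w a) J)),
        ⨆ ν : Fin (d + 1), l2OfW z ((𝔬.D U ν ∘ₗ 𝔬.G U) (embW (𝔬.w a) J)),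
        ⨆ ν : Fin (d + 1), l2OfW z ((𝔬.G U ∘ₗ 𝔬.Da U ν) (embW (𝔬.w a) J)),
        ⨆ ν : Fin (d + 1), ⨆ μ : Fin (d + 1), l2OfW z ((𝔬.D U ν ∘ₗ 𝔬.G U ∘ₗ 𝔬.Da U μ) (embW (𝔬.w a) J)),
        ⨆ ν : Fin (d + 1), ⨆ μ : Fin (d + 1), l2OfW z ((𝔬.D U ν ∘ₗ 𝔬.D U μ ∘ₗ 𝔬.G U) (embW (𝔬.w a) J)),
        ⨆ ν : Fin (d + 1), ⨆ μ : Fin (d + 1), l2OfW z ((𝔬.G U ∘ₗ 𝔬.Da U ν ∘ₗ 𝔬.Da U μ) (embW (𝔬.w a) J))] : Fin 6 → ℝ) n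
    | _, _ => 0
  glob n U lam γ := match lam with
    | .inr J => ⨆ a : S, (![wNormW i (γ + 2) (𝔬.G U (embW (𝔬.w a) J)),
        ⨆ ν : Fin (d + 1), wNormW i (γ + 1) ((𝔬.D U ν ∘ₗ 𝔬.G U) (embW (𝔬.w a) J)),
        ⨆ ν : Fin (d + 1), wNormW i (γ + 1) ((𝔬.G U ∘ₗ 𝔬.Da U ν) (embW (𝔬.w a) J)),
        wNormW i γ ((𝔬.Lap U ∘ₗ 𝔬.G U) (embW (𝔬.w a) J))] : Fin 4 → ℝ) n
    | .inl _ => 0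

/-! ### the readings unfolded (`rfl`) -/

/-- the four sup entries (3.42) of the pinned family on the bond summand, unfolded. [cite: Balaban1985BackgroundPropagators, (3.42) p.397 (bookkeeping)] -/
theorem GAOfOps_e_inr (𝔬 : GAOps W S i B) (n : Fin 4) (U : B.Cfg) (J : PBond (PV d ℓ i.m i.K hd hL) 0 → ℝ) (b : BondIdx (domT i.hN i.D i.hk)) :
    (GAOfOps 𝔬).e n U (Sum.inr J) b = ⨆ a : S, (![supInW i (β i.hN i.D i.hk b) (𝔬.G U (embW (𝔬.w a) J)),
        ⨆ ν : Fin (d + 1), supInW i (β i.hN i.D i.hk b) ((𝔬.D U ν ∘ₗ 𝔬.G U) (embW (𝔬.w a) J)),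
        ⨆ ν : Fin (d + 1), supInW i (β i.hN i.D i.hk b) ((𝔬.G U ∘ₗ 𝔬.Da U ν) (embW (𝔬.w a) J)),
        supInW i (β i.hN i.D i.hk b) ((𝔬.Lap U ∘ₗ 𝔬.G U) (embW (𝔬.w a) J))] : Fin 4 → ℝ) n :=
  rfl

/-- the four global entries (3.47) of the pinned family on the bond summand, unfolded (the shape row 12's residual `ResidualGAGlobAtOne` reads at this pin).
[cite: Balaban1985BackgroundPropagators, (3.47) p.398 (bookkeeping)] -/
theorem GAOfOps_glob_inr (𝔬 : GAOps W S i B) (n : Fin 4) (U : B.Cfg) (J : PBond (PV d ℓ i.m i.K hd hL) 0 → ℝ) (γ : ℝ) :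
    (GAOfOps 𝔬).glob n U (Sum.inr J) γ = ⨆ a : S, (![wNormW i (γ + 2) (𝔬.G U (embW (𝔬.w a) J)),
        ⨆ ν : Fin (d + 1), wNormW i (γ + 1) ((𝔬.D U ν ∘ₗ 𝔬.G U) (embW (𝔬.w a) J)),
        ⨆ ν : Fin (d + 1), wNormW i (γ + 1) ((𝔬.G U ∘ₗ 𝔬.Da U ν) (embW (𝔬.w a) J)),
        wNormW i γ ((𝔬.Lap U ∘ₗ 𝔬.G U) (embW (𝔬.w a) J))] : Fin 4 → ℝ) n :=
  rfl

/-- the entry (3.44) of the pinned family reads `0` on the SITE summand, at every `U`. [cite: Balaban1985BackgroundPropagators, (3.44) p.398 (located reading)] -/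
theorem e4_inl (𝔬 : GAOps W S i B) (U : B.Cfg) (f : ↥((Node00.toKT i).XB) → ℝ) (b : BondIdx (domT i.hN i.D i.hk)) :
    (GAOfOps 𝔬).e4 U (Sum.inl f) b = 0 :=
  rfl

/-- the entry (3.45) of the pinned family reads `0` on the SITE summand of the argument, at every `U` and every cut-off.
[cite: Balaban1985BackgroundPropagators, (3.45) p.398 (located reading)] -/
theorem h2_inl (𝔬 : GAOps W S i B) (U : B.Cfg) (f : ↥((Node00.toKT i).XB) → ℝ) (α : ℝ) (ζ : KCut i) :
    (GAOfOps 𝔬).h2 U (Sum.inl f) α ζ = 0 := by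
  cases ζ <;> rfl

/-! ## §3 The hypothesis schema «at U = 1 the letters are [4]'s» -/

/-- **«For U = 1 these theorems are proved in [4]» AS A SCHEMA ON THE LETTERS** (p. 407; p. 399: *"reduced to the corresponding theorems for propagators
without external gauge field"*): the polarisation family is inhabited by unit vectors, and at `U ≡ 1` the letters act on the embedded scalars `J·w_a` as
[4]'s operators of the genuine k-level family — `G(1) = Δ_a⁻¹` (Prop. 2.6; r03's `Gop i`), `∇_{1,ν} = DV ν c_f`, `∇*_{1,ν} = DVa ν c_f`, `Δ_1 = LapV c_f`.
A HYPOTHESIS SCHEMA of printed shape (at `U ≡ 1` every parallel transport `R(U(b))` of (3.3) is the identity); its discharge for Bałaban's operators on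
the torus of record is the instance's (NODE 00 def-Y), not this file's. [cite: Balaban1985BackgroundPropagators, Cor. 3.5 proof p.407 + p.399; Balaban1984PropagatorsII, Prop. 2.6 p.247] -/
structure GAOps.AtOne (𝔬 : GAOps W S i B) : Prop where
  nonempty : Nonempty S
  norm_w : ∀ a : S, ‖𝔬.w a‖ = 1
  G_one : ∀ (a : S) (J : PBond (PV d ℓ i.m i.K hd hL) 0 → ℝ), 𝔬.G B.one (embW (𝔬.w a) J) = embW (𝔬.w a) (Gop i J)
  D_one : ∀ (a : S) (ν : Fin (d + 1)) (f : PBond (PV d ℓ i.m i.K hd hL) 0 → ℝ), 𝔬.D B.one ν (embW (𝔬.w a) f) = embW (𝔬.w a) (DV ν i.cf f)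
  Da_one : ∀ (a : S) (ν : Fin (d + 1)) (f : PBond (PV d ℓ i.m i.K hd hL) 0 → ℝ), 𝔬.Da B.one ν (embW (𝔬.w a) f) = embW (𝔬.w a) (DVa ν i.cf f)
  Lap_one : ∀ (a : S) (f : PBond (PV d ℓ i.m i.K hd hL) 0 → ℝ), 𝔬.Lap B.one (embW (𝔬.w a) f) = embW (𝔬.w a) (LapV i.cf f)

/-! ## §4 The five `U = 1` comparisons as equalities with NODE 00's reading `Node00.GU` of [4]'s `G` -/

section AtOneMember

variable {𝔬 : GAOps W S i B} (h : 𝔬.AtOne)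
include h

/-- **(3.42) for G(1) IS (2.136) for [4]'s G** — entries `e 0..3` of the pinned family at `U = 1` EQUAL NODE 00's reading `Node00.GU` (on the bond summand:
r03's `kG` at the carrier block; on the site summand both are `0`). [cite: Balaban1985BackgroundPropagators, Cor. 3.5 p.407 + (3.42) p.397; Balaban1984PropagatorsII, (2.136) p.247] -/
theorem e_one_eq (n : Fin 4) (lam : KLoc i) (b : BondIdx (domT i.hN i.D i.hk)) : (GAOfOps 𝔬).e n B.one lam b = (GU i).e n lam b := by
  haveI := h.nonempty
  cases lam with
  | inl f => rfl
  | inr J =>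
    show _ = (kG i).e n J (β i.hN i.D i.hk b)
    simp only [GAOfOps_e_inr, kG, LinearMap.comp_apply, h.G_one, h.D_one, h.Da_one, h.Lap_one, supInW_embW i (h.norm_w _), ciSup_const]

/-- **(3.43) for G(1) IS (2.137) for [4]'s G** — the entry `h1` at `U = 1` equals NODE 00's reading. [cite: Balaban1985BackgroundPropagators, Cor. 3.5 p.407 + (3.43) p.398; Balaban1984PropagatorsII, (2.137) p.247] -/
theorem h1_one_eq (lam : KLoc i) (α : ℝ) (ζ : KCut i) : (GAOfOps 𝔬).h1 B.one lam α ζ = (GU i).h1 lam α ζ := by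
  haveI := h.nonempty
  cases lam with
  | inl f => cases ζ <;> rfl
  | inr J =>
    cases ζ with
    | inl z => rfl
    | inr z =>
      show (⨆ a : S, max _ _) = (kG i).h1 J α z
      simp only [kG, LinearMap.comp_apply, h.G_one, h.D_one, h.Da_one, holderQW_embW i (h.norm_w _), ciSup_const]

/-- **(3.44) for G(1) IS (2.138) for [4]'s G** — the entry `e4` at `U = 1` equals NODE 00's reading. [cite: Balaban1985BackgroundPropagators, Cor. 3.5 p.407 + (3.44) p.398; Balaban1984PropagatorsII, (2.138) p.247] -/
theorem e4_one_eq (lam : KLoc i) (b : BondIdx (domT i.hN i.D i.hk)) : (GAOfOps 𝔬).e4 B.one lam b = (GU i).e4 lam b := by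
  haveI := h.nonempty
  cases lam with
  | inl f => rfl
  | inr J =>
    show (⨆ a : S, _) = (kG i).e4 J (β i.hN i.D i.hk b)
    simp only [kG, LinearMap.comp_apply, h.G_one, h.D_one, h.Da_one, supInW_embW i (h.norm_w _), ciSup_const]

/-- **(3.45) for G(1) IS (2.139) for [4]'s G** — the entry `h2` at `U = 1` equals NODE 00's reading. [cite: Balaban1985BackgroundPropagators, Cor. 3.5 p.407 + (3.45) p.398; Balaban1984PropagatorsII, (2.139) p.247] -/
theorem h2_one_eq (lam : KLoc i) (α : ℝ) (ζ : KCut i) : (GAOfOps 𝔬).h2 B.one lam α ζ = (GU i).h2 lam α ζ := by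
  haveI := h.nonempty
  cases lam with
  | inl f => cases ζ <;> rfl
  | inr J =>
    cases ζ with
    | inl z => rfl
    | inr z =>
      show (⨆ a : S, _) = (kG i).h2 J α z
      simp only [kG, LinearMap.comp_apply, h.G_one, h.D_one, h.Da_one, holderQW_embW i (h.norm_w _), ciSup_const]

/-- **(3.46) for G(1) IS (2.140) for [4]'s G** — entries `l2 0..5` at `U = 1` equal NODE 00's reading. [cite: Balaban1985BackgroundPropagators, Cor. 3.5 p.407 + (3.46) p.398; Balaban1984PropagatorsII, (2.140) p.247] -/
theorem l2_one_eq (n : Fin 6) (lam : KLoc i) (hc : KCut i) : (GAOfOps 𝔬).l2 n B.one lam hc = (GU i).l2 n lam hc := by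
  haveI := h.nonempty
  cases lam with
  | inl f => cases hc <;> rfl
  | inr J =>
    cases hc with
    | inl z => rfl
    | inr z =>
      show (⨆ a : S, _) = (kG i).l2 n J z
      simp only [kG, LinearMap.comp_apply, h.G_one, h.D_one, h.Da_one, l2OfW_embW (h.norm_w _), ciSup_const]

end AtOneMember

end Letters

/-! ## §5 At the member type of the [B9] bundle of record: the certificate's binder shapes, from the pin -/

section Member

variable {Mstar : ℕ} {W : MemberY d ℓ hd hL b₀ b₁ Mstar → Type} [∀ x, NormedAddCommGroup (W x)] [∀ x, NormedSpace ℝ (W x)]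
  {S : MemberY d ℓ hd hL b₀ b₁ Mstar → Type} {B : MemberY d ℓ hd hL b₀ b₁ Mstar → B9.Backgrounds}
  {𝔬 : ∀ x : MemberY d ℓ hd hL b₀ b₁ Mstar, GAOps (W x) (S x) x.toKIdx (B x)}
  {GA : ∀ x : MemberY d ℓ hd hL b₀ b₁ Mstar, B9.KernelFamily (geo9Y x) (B x)}

/-- **ROW 4 `hGA_e` OF THE N06 CERTIFICATE FROM THE PIN**: at every member, with the layer's `G(U)` family PINNED to the letters (`GA x = GAOfOps (𝔬 x)`) and
the letters [4]'s at `U = 1` (`(𝔬 x).AtOne`), the (3.42) entries at `U ≡ 1` are bounded by (indeed equal to) NODE 00's reading `Node00.GU x.toKIdx` of [4]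
Prop. 2.6 — the binder `hGA_e` of the certificate ∕ the field `B9FromB6.DictAtOne.GA_e` at `dictAtOneY`, any backgrounds (at the record `bg9Y (M_N ℂ) SU(N) x`).
[cite: Balaban1985BackgroundPropagators, Cor. 3.5 p.407 + (3.42) p.397; Balaban1984PropagatorsII, Prop. 2.6 (2.136) p.247] -/
theorem hGA_e_of_pin (hpin : ∀ x, GA x = GAOfOps (𝔬 x)) (h1 : ∀ x, (𝔬 x).AtOne) :
    ∀ (x : MemberY d ℓ hd hL b₀ b₁ Mstar) (n : Fin 4) (lam : (geo9Y x).Loc) (y : (geo9Y x).Site),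
      (GA x).e n (B x).one lam y ≤ (Node00.GU x.toKIdx).e n lam y := fun x n lam y => by
  rw [hpin x]
  exact (e_one_eq (h1 x) n lam y).le

/-- **ROW 5 `hGA_h1`** from the pin: the (3.43) entry at `U ≡ 1` is bounded by (equal to) NODE 00's reading ((2.137)).
[cite: Balaban1985BackgroundPropagators, Cor. 3.5 p.407 + (3.43) p.398; Balaban1984PropagatorsII, Prop. 2.6 (2.137) p.247] -/
theorem hGA_h1_of_pin (hpin : ∀ x, GA x = GAOfOps (𝔬 x)) (h1 : ∀ x, (𝔬 x).AtOne) :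
    ∀ (x : MemberY d ℓ hd hL b₀ b₁ Mstar) (lam : (geo9Y x).Loc) (b : ℝ) (c : (geo9Y x).Cut),
      (GA x).h1 (B x).one lam b c ≤ (Node00.GU x.toKIdx).h1 lam b c := fun x lam b c => by
  rw [hpin x]
  exact (h1_one_eq (h1 x) lam b c).le

/-- **ROW 6 `hGA_e4`** from the pin: the (3.44) entry at `U ≡ 1` is bounded by (equal to) NODE 00's reading ((2.138)).
[cite: Balaban1985BackgroundPropagators, Cor. 3.5 p.407 + (3.44) p.398; Balaban1984PropagatorsII, Prop. 2.6 (2.138) p.247] -/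
theorem hGA_e4_of_pin (hpin : ∀ x, GA x = GAOfOps (𝔬 x)) (h1 : ∀ x, (𝔬 x).AtOne) :
    ∀ (x : MemberY d ℓ hd hL b₀ b₁ Mstar) (lam : (geo9Y x).Loc) (y : (geo9Y x).Site),
      (GA x).e4 (B x).one lam y ≤ (Node00.GU x.toKIdx).e4 lam y := fun x lam y => by
  rw [hpin x]
  exact (e4_one_eq (h1 x) lam y).le

/-- **ROW 7 `hGA_h2`** from the pin: the (3.45) entry at `U ≡ 1` is bounded by (equal to) NODE 00's reading ((2.139)).
[cite: Balaban1985BackgroundPropagators, Cor. 3.5 p.407 + (3.45) p.398; Balaban1984PropagatorsII, Prop. 2.6 (2.139) p.247] -/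
theorem hGA_h2_of_pin (hpin : ∀ x, GA x = GAOfOps (𝔬 x)) (h1 : ∀ x, (𝔬 x).AtOne) :
    ∀ (x : MemberY d ℓ hd hL b₀ b₁ Mstar) (lam : (geo9Y x).Loc) (b : ℝ) (c : (geo9Y x).Cut),
      (GA x).h2 (B x).one lam b c ≤ (Node00.GU x.toKIdx).h2 lam b c := fun x lam b c => by
  rw [hpin x]
  exact (h2_one_eq (h1 x) lam b c).le

/-- **ROW 8 `hGA_l2`** from the pin: the six (3.46) entries at `U ≡ 1` are bounded by (equal to) NODE 00's reading ((2.140)).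
[cite: Balaban1985BackgroundPropagators, Cor. 3.5 p.407 + (3.46) p.398; Balaban1984PropagatorsII, Prop. 2.6 (2.140) p.247] -/
theorem hGA_l2_of_pin (hpin : ∀ x, GA x = GAOfOps (𝔬 x)) (h1 : ∀ x, (𝔬 x).AtOne) :
    ∀ (x : MemberY d ℓ hd hL b₀ b₁ Mstar) (n : Fin 6) (lam : (geo9Y x).Loc) (hc : (geo9Y x).Cut),
      (GA x).l2 n (B x).one lam hc ≤ (Node00.GU x.toKIdx).l2 n lam hc := fun x n lam hc => by
  rw [hpin x]
  exact (l2_one_eq (h1 x) n lam hc).le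

end Member

/-! ## §6 (v1.1) The pin over COMPLEX-linear letters on the unit sphere — the instantiation at the record's algebra

At the record the letters of `G(U)` are `ℂ`-linear operators on `𝔸`-valued fine-bond functions (`𝔸 = M_N(ℂ)` a complete normed `ℂ`-algebra;
NODE 00 def-Y's `CovLettersY`, announced pub-ymgap INBOX 2026-08-26T18:03:58Z) and the scalar argument is lifted as `z ↦ (f z : ℂ)·E` along
directions `E`.  `GAOps.ofC` is that instantiation of §2 — `W := 𝔸` with its real structure `NormedSpace.complexToReal`, `S :=` THE UNIT SPHERE of `𝔸`,
`w := Subtype.val`, the letters restricted to `ℝ` — and `GAOps.AtOne.ofC` builds the schema of §3 from four flatness identities stated for the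
`ℂ`-linear letters on unit directions plus ONE unit vector (e.g. `1` under `NormOneClass`); `embW_apply_eq_coe_smul` is the bridge to the complex lift
(`(r : ℂ)·E = r·E`, `Complex.coe_smul`).  So an operator layer with `GA := GAOfOps (GAOps.ofC G D Da Lap)` meets rows 4–8 of the certificate by
`hGA_*_of_pin (fun _ => rfl) (fun x => GAOps.AtOne.ofC …)`.  Nothing asserted; the identities are hypotheses (their discharge is the instance's). -/

section ComplexLetters

variable {W : Type} [NormedAddCommGroup W] [NormedSpace ℂ W] {i : KIdx d ℓ hd hL b₀ b₁} {B : B9.Backgrounds}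

/-- the real polarised embedding IS the complex lift of def-Y's reading: `(J·E)(z) = (J z : ℂ)·E` (`Complex.coe_smul`, `rfl`).
[cite: Balaban1985BackgroundPropagators, Thm 3.3 p.399 («J … with values in 𝔤»; reading, bookkeeping)] -/
theorem embW_apply_eq_coe_smul {X : Type} (E : W) (f : X → ℝ) (x : X) : embW E f x = ((f x : ℝ) : ℂ) • E :=
  (Complex.coe_smul (f x) E).symm

/-- **THE LETTERS OF `G(U)` FROM `ℂ`-LINEAR LATTICE OPERATORS, POLARISED ON THE UNIT SPHERE**: `W := 𝔸` (real structure by restriction of scalars),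
`S := {E : 𝔸 | ‖E‖ = 1}`, `w := Subtype.val`, `G U := (G U)|_ℝ`, `D U ν := (D U ν)|_ℝ`, `Da U ν := (Da U ν)|_ℝ`, `Lap U := (Lap U)|_ℝ` — the instantiation of
`GAOps` at the record's algebra.  A repackaging of PARAMETERS; nothing constructed. [cite: Balaban1985BackgroundPropagators, (3.3) p.390, (3.27) p.395, Thm 3.3 p.399 (the letters; bookkeeping)] -/
def GAOps.ofC (G : B.Cfg → ((PBond (PV d ℓ i.m i.K hd hL) 0 → W) →ₗ[ℂ] (PBond (PV d ℓ i.m i.K hd hL) 0 → W)))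
    (D Da : B.Cfg → Fin (d + 1) → ((PBond (PV d ℓ i.m i.K hd hL) 0 → W) →ₗ[ℂ] (PBond (PV d ℓ i.m i.K hd hL) 0 → W)))
    (Lap : B.Cfg → ((PBond (PV d ℓ i.m i.K hd hL) 0 → W) →ₗ[ℂ] (PBond (PV d ℓ i.m i.K hd hL) 0 → W))) :
    GAOps W (Metric.sphere (0 : W) 1) i B where
  w := Subtype.val
  G U := (G U).restrictScalars ℝ
  D U ν := (D U ν).restrictScalars ℝ
  Da U ν := (Da U ν).restrictScalars ℝ
  Lap U := (Lap U).restrictScalars ℝ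

/-- **`AtOne` FOR THE SPHERE-POLARISED COMPLEX LETTERS FROM FOUR FLATNESS IDENTITIES AND ONE UNIT VECTOR**: if `𝔸` has a unit vector `E₀` (e.g. `1`) and at
`U ≡ 1` the `ℂ`-linear letters act on every `J·E`, `‖E‖ = 1`, as [4]'s `Gop i`, `DV ν c_f`, `DVa ν c_f`, `LapV c_f` (p. 407: «There we have proved these
theorems for operators with the external gauge field configuration U = 1»; at `U ≡ 1` every `R(U(b))` of (3.3) is the identity), then the letters
`GAOps.ofC G D Da Lap` satisfy `GAOps.AtOne` — hence rows 4–8 of the certificate for a layer pinned to `GAOfOps (GAOps.ofC G D Da Lap)`.  The identities are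
HYPOTHESES (the instance discharges them). [cite: Balaban1985BackgroundPropagators, Cor. 3.5 proof p.407 + p.399; Balaban1984PropagatorsII, Prop. 2.6 p.247] -/
theorem GAOps.AtOne.ofC {G : B.Cfg → ((PBond (PV d ℓ i.m i.K hd hL) 0 → W) →ₗ[ℂ] (PBond (PV d ℓ i.m i.K hd hL) 0 → W))}
    {D Da : B.Cfg → Fin (d + 1) → ((PBond (PV d ℓ i.m i.K hd hL) 0 → W) →ₗ[ℂ] (PBond (PV d ℓ i.m i.K hd hL) 0 → W))}
    {Lap : B.Cfg → ((PBond (PV d ℓ i.m i.K hd hL) 0 → W) →ₗ[ℂ] (PBond (PV d ℓ i.m i.K hd hL) 0 → W))}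
    (E₀ : W) (hE₀ : ‖E₀‖ = 1)
    (hG : ∀ E : W, ‖E‖ = 1 → ∀ J : PBond (PV d ℓ i.m i.K hd hL) 0 → ℝ, G B.one (embW E J) = embW E (Gop i J))
    (hD : ∀ E : W, ‖E‖ = 1 → ∀ (ν : Fin (d + 1)) (f : PBond (PV d ℓ i.m i.K hd hL) 0 → ℝ), D B.one ν (embW E f) = embW E (DV ν i.cf f))
    (hDa : ∀ E : W, ‖E‖ = 1 → ∀ (ν : Fin (d + 1)) (f : PBond (PV d ℓ i.m i.K hd hL) 0 → ℝ), Da B.one ν (embW E f) = embW E (DVa ν i.cf f))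
    (hLap : ∀ E : W, ‖E‖ = 1 → ∀ f : PBond (PV d ℓ i.m i.K hd hL) 0 → ℝ, Lap B.one (embW E f) = embW E (LapV i.cf f)) :
    (GAOps.ofC G D Da Lap).AtOne where
  nonempty := ⟨⟨E₀, mem_sphere_zero_iff_norm.2 hE₀⟩⟩
  norm_w a := mem_sphere_zero_iff_norm.1 a.2
  G_one a J := hG a.1 (mem_sphere_zero_iff_norm.1 a.2) J
  D_one a ν f := hD a.1 (mem_sphere_zero_iff_norm.1 a.2) ν f
  Da_one a ν f := hDa a.1 (mem_sphere_zero_iff_norm.1 a.2) ν f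
  Lap_one a f := hLap a.1 (mem_sphere_zero_iff_norm.1 a.2) f

/-- **ROWS 4–8 FOR A LAYER PINNED TO THE SPHERE-POLARISED COMPLEX LETTERS, entry (3.42)** (the other four entries: `h1_one_eq` … `l2_one_eq` ∕ `hGA_*_of_pin`
with the same two arguments): under the flatness identities the sup entries of `GAOfOps (GAOps.ofC G D Da Lap)` at `U ≡ 1` EQUAL NODE 00's `Node00.GU`.
[cite: Balaban1985BackgroundPropagators, Cor. 3.5 p.407 + (3.42) p.397; Balaban1984PropagatorsII, Prop. 2.6 (2.136) p.247] -/
theorem e_one_eq_ofC {G : B.Cfg → ((PBond (PV d ℓ i.m i.K hd hL) 0 → W) →ₗ[ℂ] (PBond (PV d ℓ i.m i.K hd hL) 0 → W))}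
    {D Da : B.Cfg → Fin (d + 1) → ((PBond (PV d ℓ i.m i.K hd hL) 0 → W) →ₗ[ℂ] (PBond (PV d ℓ i.m i.K hd hL) 0 → W))}
    {Lap : B.Cfg → ((PBond (PV d ℓ i.m i.K hd hL) 0 → W) →ₗ[ℂ] (PBond (PV d ℓ i.m i.K hd hL) 0 → W))}
    (E₀ : W) (hE₀ : ‖E₀‖ = 1)
    (hG : ∀ E : W, ‖E‖ = 1 → ∀ J : PBond (PV d ℓ i.m i.K hd hL) 0 → ℝ, G B.one (embW E J) = embW E (Gop i J))
    (hD : ∀ E : W, ‖E‖ = 1 → ∀ (ν : Fin (d + 1)) (f : PBond (PV d ℓ i.m i.K hd hL) 0 → ℝ), D B.one ν (embW E f) = embW E (DV ν i.cf f))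
    (hDa : ∀ E : W, ‖E‖ = 1 → ∀ (ν : Fin (d + 1)) (f : PBond (PV d ℓ i.m i.K hd hL) 0 → ℝ), Da B.one ν (embW E f) = embW E (DVa ν i.cf f))
    (hLap : ∀ E : W, ‖E‖ = 1 → ∀ f : PBond (PV d ℓ i.m i.K hd hL) 0 → ℝ, Lap B.one (embW E f) = embW E (LapV i.cf f))
    (n : Fin 4) (lam : KLoc i) (b : BondIdx (domT i.hN i.D i.hk)) :
    (GAOfOps (GAOps.ofC G D Da Lap)).e n B.one lam b = (GU i).e n lam b :=
  e_one_eq (GAOps.AtOne.ofC E₀ hE₀ hG hD hDa hLap) n lam b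

end ComplexLetters

end Literature.MathematicalPhysics.QuantumFieldTheory.Balaban1983to89.B9Cor35ComparisonsGA

end
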